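import Literature.AnabelianGeometry.EtaleTheta.ThetaBiSystems
import Literature.AnabelianGeometry.EtaleTheta.Discharge.Sec2TowerLemmas

/-!
# [EtTh] §2 discharge: Corollary 2.19 (iii), second half (the induced projective system of bi-theta
# environments) — proof-only companion of `ThetaBiSystems.lean`

Mochizuki, *The Étale Theta Function and its Frobenioid-theoretic Manifestations* [EtTh],
Publ. RIMS 45 (2009), §2, Cor 2.19 (iii) p.65 (locators `p.N` = PDF pages of the PRIMS text; bib
key `MochizukiEtTh2009`). PROOF-ONLY companion (no `def`, no new named fact; seat abc-iut-L2-d1, DAG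
node `EtTh:Cor2.19(iii)`, LONG-CHAINS lane C2) of `ThetaBiSystems.lean` (seat abc-iut-L2-t2;
nothing there is edited or restated).

`ThetaEnvTower.exists_biThetaIso_shift` — for the natural projective system of mono-theta
environments (compatible theta cocycles `η_M`) and a compatible, CONTINUOUS (locally constant after
inflation to `Π^tp_X`) family of `G_K`-cocycles `c_M`, the shifts by the inflated cocycles
`(c_M ∘ aug)⁻¹` (Prop 2.14 (ii); members of the Kummer part of `D_Y`, Def 2.13 (i)) are isomorphisms
of bi-theta environments `(Π_Y[μ_M], D_Y, [s^Θ_{η_M}], [s^alg·c_M]) ≅ (Π_Y[μ_M], D_Y, [s^Θ_{η_M c_M}],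
[s^alg])` compatible with the reductions — "adding the resulting classes to the theta sections … one
obtains a projective system of bi-theta environments … isomorphic to some natural projective system
of bi-theta environments" (p.65). This is the content of the re-typed named fact
`ThetaEnvTower.Cor219_iii_systems` once the continuity of `c_M ∘ aug` is among its hypotheses
(R-9 note abc-iut-L2-d1, INBOX 2026-08-25). HONEST FRAMING: no side is taken on [IUTchIII] Cor 3.12;
typed ≠ discharged elsewhere.
-/

namespace Literature.AnabelianGeometry.EtaleTheta

universe u

namespace ThetaEnvTower

variable {E : Set ℕ+} (T : ThetaEnvTower.{u} E)

/-- The inflation to `Π^tp_Y` of the inverse of a `G_K`-cocycle is a cocycle for `Π^tp_Y[μ_M]`.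
[cite: MochizukiEtTh2009, Prop 2.14(ii) p.49] -/
theorem isEnvCocycle_inflate_inv (M : E) {c : T.G → T.mu M}
    (hc : CycEnvelope.IsEnvCocycle (MonoidHom.id T.G) (T.chi M) c) :
    CycEnvelope.IsEnvCocycle (T.level M).augY (T.level M).chi
      (fun g : T.PiY => (c (T.aug (g : T.PiX)))⁻¹) :=
  (hc.comp (T.level M).augY).inv

/-- A shift by a locally constant cocycle is an automorphism of the TOPOLOGICAL group `Π^tp_Y[μ_M]`.
[cite: MochizukiEtTh2009, Prop 2.14(ii) p.49] -/
theorem shift_mem_contMulAut (M : E) {δ : T.PiY → T.mu M}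
    (hδ : CycEnvelope.IsEnvCocycle (T.level M).augY (T.level M).chi δ) (hcont : Continuous δ) :
    CycEnvelope.shift hδ ∈ contMulAut (T.level M).env := by
  have hm : Continuous fun p : T.mu M × T.mu M => p.1 * p.2 := continuous_of_discreteTopology
  refine ⟨?_, ?_⟩
  · change Continuous fun x : (T.level M).env => CycEnvelope.shift hδ x
    simp only [CycEnvelope.shift_apply]
    exact (T.level M).continuous_env_mk
      (hm.comp ((T.level M).continuous_left.prodMk (hcont.comp (T.level M).continuous_right)))
      (T.level M).continuous_right
  · change Continuous fun x : (T.level M).env => (CycEnvelope.shift hδ).symm x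
    simp only [CycEnvelope.shift_symm_apply]
    exact (T.level M).continuous_env_mk
      (hm.comp ((T.level M).continuous_left.prodMk
        ((continuous_of_discreteTopology.comp hcont).comp (T.level M).continuous_right)))
      (T.level M).continuous_right

/-- Conjugation by an element of `D_Y` preserves `D_Y`. [cite: MochizukiEtTh2009, Def 2.13(i) p.47] -/
theorem map_conj_DY_eq (M : E) {d : TopOut (T.level M).env} (hd : d ∈ (T.level M).DY) :
    (T.level M).DY.map (MulAut.conj d).toMonoidHom = (T.level M).DY := by
  ext y
  constructor
  · rintro ⟨x, hx, rfl⟩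
    exact (T.level M).DY.mul_mem ((T.level M).DY.mul_mem hd hx) ((T.level M).DY.inv_mem hd)
  · intro hy
    refine ⟨d⁻¹ * y * d, (T.level M).DY.mul_mem ((T.level M).DY.mul_mem
      ((T.level M).DY.inv_mem hd) hy) hd, ?_⟩
    change d * (d⁻¹ * y * d) * d⁻¹ = y
    group

/-- The reductions commute with the shifts by a compatible family of inflated cocycles.
[cite: MochizukiEtTh2009, Cor 2.19(iii) p.65] -/
theorem redEnv_shift_inflate {M M' : E} (h : (M : ℕ+) ∣ M') {c : T.G → T.mu M}
    {c' : T.G → T.mu M'} (hc : CycEnvelope.IsEnvCocycle (MonoidHom.id T.G) (T.chi M) c)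
    (hc' : CycEnvelope.IsEnvCocycle (MonoidHom.id T.G) (T.chi M') c')
    (hcc : T.red M M' h ∘ c' = c) (x : (T.level M').env) :
    T.redEnv M M' h (CycEnvelope.shift (T.isEnvCocycle_inflate_inv M' hc') x) =
      CycEnvelope.shift (T.isEnvCocycle_inflate_inv M hc) (T.redEnv M M' h x) := by
  ext
  · simp only [CycEnvelope.shift_apply, left_redEnv, right_redEnv, map_mul, map_inv]
    rw [← hcc]
    rfl
  · rfl

/-- **Corollary 2.19 (iii), second half — the construction**: for compatible theta cocycles `η_M`
and a compatible family of inflated `G_K`-cocycles `c_M` that are CONTINUOUS on `Π^tp_X`, the shifts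
by `(c_M ∘ aug)⁻¹` are isomorphisms of bi-theta environments
`(Π_Y[μ_M], D_Y, [s^Θ_{η_M}], [s^alg·c_M]) ≅ (Π_Y[μ_M], D_Y, [s^Θ_{η_M·c_M}], [s^alg])`, compatible with
the reductions. [cite: MochizukiEtTh2009, Cor 2.19(iii) p.65] -/
theorem exists_biThetaIso_shift (η : ∀ M : E, T.PiYdd → T.mu M) (hη : ∀ M, η M ∈ T.thetaCocycles M)
    (c : ∀ M : E, T.G → T.mu M)
    (hc : ∀ M, CycEnvelope.IsEnvCocycle (MonoidHom.id T.G) (T.chi M) (c M))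
    (hcc : ∀ (M M' : E) (h : (M : ℕ+) ∣ M'), T.red M M' h ∘ c M' = c M)
    (hcont : ∀ M, IsLocallyConstant (c M ∘ T.aug)) :
    ∃ α : ∀ M : E, BiThetaEnv.Iso
        { Pi := (T.level M).env, D := (T.level M).DY,
          sTheta := CycEnvelope.muConjClass (T.level M).augY (T.chi M)
            ((T.level M).sTheta (hη M)).range,
          sAlg := CycEnvelope.muConjClass (T.level M).augY (T.chi M) (T.twistedAlg M (hc M)).range }
        { Pi := (T.level M).env, D := (T.level M).DY,
          sTheta := CycEnvelope.muConjClass (T.level M).augY (T.chi M)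
            (T.sectionOf M (η M * (c M ∘ T.aug ∘ T.PiYdd.subtype))
              (T.isEnvCocycle_mul_inflate M (T.isCocycle M (η M) (hη M)) (hc M))).range,
          sAlg := CycEnvelope.muConjClass (T.level M).augY (T.chi M) (T.level M).sAlg.range },
      ∀ (M M' : E) (h : (M : ℕ+) ∣ M') (x : (T.level M').env),
        T.redEnv M M' h ((α M').e x) = (α M).e (T.redEnv M M' h x) := by
  -- the shift at level `M`, as an automorphism of the topological group `Π_Y[μ_M]`
  have hcM : ∀ M : E, Continuous fun g : T.PiY => (c M (T.aug (g : T.PiX)))⁻¹ := fun M =>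
    continuous_of_discreteTopology.comp (((hcont M).continuous).comp continuous_subtype_val)
  have hκ : ∀ M : E, CycEnvelope.shift (T.isEnvCocycle_inflate_inv M (hc M)) ∈
      contMulAut (T.level M).env := fun M => T.shift_mem_contMulAut M _ (hcM M)
  -- `[shift] ∈ D_Y` (a Kummer generator)
  have hmem : ∀ M : E, TopOut.mk _ ⟨_, hκ M⟩ ∈ (T.level M).DY := fun M =>
    Subgroup.subset_closure (Set.mem_union_left _ ⟨fun g => (c M g)⁻¹,
      T.isEnvCocycle_inflate_inv M (hc M), hκ M, rfl⟩)
  refine ⟨fun M =>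
    { e := ContinuousMulEquiv.mk (CycEnvelope.shift (T.isEnvCocycle_inflate_inv M (hc M)))
        (hκ M).1 (hκ M).2
      map_D := ?_
      map_sTheta := ?_
      map_sAlg := ?_ }, fun M M' h x => T.redEnv_shift_inflate h (hc M) (hc M') (hcc M M' h) x⟩
  · -- transport along the shift = conjugation by `[shift] ∈ D_Y`
    change (T.level M).DY.map (TopOut.transport _) = (T.level M).DY
    have ht : TopOut.transport (ContinuousMulEquiv.mk
        (CycEnvelope.shift (T.isEnvCocycle_inflate_inv M (hc M))) (hκ M).1 (hκ M).2) =
        (MulAut.conj (TopOut.mk _ ⟨_, hκ M⟩)).toMonoidHom := by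
      refine MonoidHom.ext fun d => ?_
      obtain ⟨φ, rfl⟩ := QuotientGroup.mk'_surjective _ d
      change TopOut.transport _ (TopOut.mk _ φ) = TopOut.mk _ _ * TopOut.mk _ φ * (TopOut.mk _ _)⁻¹
      rw [ThetaEnvData.transport_mk, ← map_mul, ← map_inv, ← map_mul]
      exact congrArg _ (Subtype.ext (MulEquiv.ext fun x => rfl))
    rw [ht]
    exact T.map_conj_DY_eq M (hmem M)
  · change (fun H : Subgroup (T.level M).env =>
        H.map (CycEnvelope.shift (T.isEnvCocycle_inflate_inv M (hc M))).toMonoidHom) ''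
        CycEnvelope.muConjClass (T.level M).augY (T.chi M) ((T.level M).sTheta (hη M)).range = _
    rw [CycEnvelope.image_muConjClass_eq _ _ _ (fun a => CycEnvelope.shift_inMu _ a),
      MonoidHom.map_range]
    congr 1
    congr 1
    refine MonoidHom.ext fun g => ?_
    ext
    · simp only [MonoidHom.coe_comp, Function.comp_apply, MulEquiv.coe_toMonoidHom,
        CycEnvelope.shift_apply, ThetaEnvData.sTheta, sectionOf, MonoidHom.coe_mk, OneHom.coe_mk,
        Pi.mul_apply, Function.comp_apply, Subgroup.coe_subtype, mul_inv_rev]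
      rw [mul_comm]
      rfl
    · rfl
  · change (fun H : Subgroup (T.level M).env =>
        H.map (CycEnvelope.shift (T.isEnvCocycle_inflate_inv M (hc M))).toMonoidHom) ''
        CycEnvelope.muConjClass (T.level M).augY (T.chi M) (T.twistedAlg M (hc M)).range = _
    rw [CycEnvelope.image_muConjClass_eq _ _ _ (fun a => CycEnvelope.shift_inMu _ a),
      MonoidHom.map_range]
    congr 1
    congr 1
    refine MonoidHom.ext fun g => ?_
    ext
    · simp only [MonoidHom.coe_comp, Function.comp_apply, MulEquiv.coe_toMonoidHom,
        CycEnvelope.shift_apply, ThetaEnvData.sAlg, twistedAlg, MonoidHom.coe_mk, OneHom.coe_mk]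
      exact mul_inv_cancel (c M (T.aug (g : T.PiX)))
    · rfl

/-- **Corollary 2.19 (iii), second half — the named fact `ThetaEnvTower.Cor219_iii_systems` DISCHARGED**
(unconditionally over the interface: the continuity of `c_M ∘ aug` is among its hypotheses).
[cite: MochizukiEtTh2009, Cor 2.19(iii) p.65] -/
theorem cor219_iii_systems_holds : T.Cor219_iii_systems :=
  fun η hη _ c hc hcont hcc => T.exists_biThetaIso_shift η hη c hc hcc hcont

end ThetaEnvTower

end Literature.AnabelianGeometry.EtaleTheta
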